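import Summits.BirchSwinnertonDyer.BirchSwinnertonDyer.Theorems.AdditiveKolyvaginRoadLevelSystemsRigidity
import HarnessLib

/-!
# Route `AdditiveKolyvaginRoad`, crux `LevelKolyvaginSystemsAdditive` (item stmt-BirchSwinnertonDyer-21396, KS′):
# a level Kolyvagin system from even-level classes, transport, ONE IGNITION and CONNECTIVITY — the base case (A5) without
# a rank-0 anchor at every level
# (cell `pub/bsd-wall`, width seat `bsd-wall-akr-p2x-w2` g2; `--supports stmt-BirchSwinnertonDyer-21396`, helper; part 3 of 3,
# after `…LevelSystemsRigidityCore` ∕ `…LevelSystemsRigidity`)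

WHAT. Two assemblies of `Nonempty (LevelKolyvaginSystemP W K p Dt β ι c)` — the conclusion of crux KS′ at a frame — in which
the field `baseCase` («`c(1, n) ≠ 0` at every non-empty even level of canonical rank one», W. Zhang Thm. 7.2) is NOT fed by a
rank-0 anchor at every odd level ((γ) of w2's `nonempty_levelKolyvaginSystemP_of_bipartite`, (FF) of w3's
`nonempty_levelKolyvaginSystemP_of_reciprocity_of_firstFloor` — unprinted at `p² ∣ N`, DEAD-LINES D2/D3) but by Howard's
RIGIDITY over `𝔽_p` (parts 1–2): ONE SEED + CONNECTIVITY of Howard's core graph.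
* `nonempty_levelKolyvaginSystemP_of_reciprocity_of_ignition` (congruence form): even-level classes with the carrier's local
  axioms, (SRL) W. Zhang Thm 4.3 two-sided (w3's binder verbatim), `selmer_bottom` (the conductor-one bottom class `c(1)` is a
  signed Selmer class — Gross 1991; vacuous when `c(1) ≡ 0`), IGNITION `κ₀(∅, n₀) ≠ 0` at ONE even level, and RUNG-CONNECTIVITY
  of every rank-one non-empty even level to `n₀`.
* `nonempty_levelKolyvaginSystemP_of_bipartite_of_seed` (bipartite form): even-level classes, odd-level values `λ`, laws (A),
  (B) TWO-SIDED, `selmer_bottom`, ONE SEED (a non-zero class at an even level OR a unit value `λ(∅, n₀)` at an odd level — ONE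
  instance of the anchor), and CORE-CONNECTIVITY.
Neither uses a ♯-frame hypothesis ((A1) is not needed for rigidity; it re-enters only in the SUPPLY of connectivity, part 2
§4). The seed is where a line puts its content: `n₀ = ∅` with `p ∤ [E(K) : ℤ y_K]` (then nothing is asked — BOT′'s regime),
a COMPUTED non-vanishing (crux idea `additive-fibre-ignition`: its `RigidityBaseCase_ALG` is exactly «seed + connectivity ⟹
baseCase», split here into the landed rigidity and the residual connectivity), or ONE special value in the range of print.

HONEST FRAMING: theorems only; 0 definitions, 0 named facts, 0 `sorry`; every producer-shape statement is a HYPOTHESIS;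
CONDITIONAL; closes nothing. The crux's open content at `p² ∣ N` — geometric classes at the 2-prime levels (K1), the
multiplicity-one input of the laws, the seed, and the E-side connectivity (Howard Prop. 2.4.11; tree: (A1) landed, (R) modulo
Poitou–Tate) — is untouched. BSD is not proved by any of this.

References: [cite: Howard2006Bipartite, Prop. 2.4.11, Cor. 2.4.12, Thm. 2.5.1] [cite: WZhang2014, Thm. 4.3, (4.8), Thm. 7.2,
§8.1, §9] [cite: BertoliniDarmon2005, Thm. 4.1, Thm. 4.2] [cite: GrossLMS1991, Prop. 6.2].
-/

-- single-conjunct summit: `Summit.BirchSwinnertonDyer.BirchSwinnertonDyer.…` repeats the name by design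
set_option linter.dupNamespace false

noncomputable section

open scoped Classical

namespace Summit.BirchSwinnertonDyer.BirchSwinnertonDyer.Theorems.AdditiveKoly

open WeierstrassCurve NumberField IsDedekindDomain
  Literature.NumberTheory.EllipticCurves Literature.NumberTheory.EllipticCurves.ModularForms
  Literature.NumberTheory.EllipticCurves.Rank1Residual Literature.NumberTheory.GaloisRepresentations Module
  Summit.BirchSwinnertonDyer.Rank1Residual.X11b.Three.Koly

variable (W : WeierstrassCurve ℚ) (K : Type) [Field K] [NumberField K] (p : ℕ) [W.IsGloballyMinimal]
  (c : K ≃ₐ[ℚ] K) [Module (ZMod p) (Vp W K p)]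

/-! ## §3 Assemblies: a level Kolyvagin system from even-level classes, transport, ONE seed and connectivity -/

section Assembly

variable [NeZero (W.conductorNorm ℤ)] [Fact p.Prime]
  (Dt : ModularParametrizationData W (W.conductorNorm ℤ)) (β : ℤ) (ι : K →+* ℂ)

/-- **KS′'s conclusion from Zhang-shape classes, the congruence (SRL), ONE IGNITION and RUNG-CONNECTIVITY** — w3's
`nonempty_levelKolyvaginSystemP_of_reciprocity_of_firstFloor` with the first floor (FF) (= the rank-0 anchor (γ) + period
bridge (δ) AT EVERY LEVEL, unprinted at `p² ∣ N`) REPLACED by: (i) `selmer_bottom` — the conductor-one bottom class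
`κ₀(∅, ∅) = c(1)` is a signed class of `Sel_∅` (Gross 1991: `c(1) = δ(y_K)` is a Selmer class in the `ε`-eigenspace;
vacuous when `c(1) ≡ 0`); (ii) IGNITION — at ONE even level `n₀` the conductor-one class is non-zero (e.g. `n₀ = ∅` when
`p ∤ [E(K) : ℤ y_K]`, or a level where it is COMPUTED to be non-zero); (iii) CONNECTED — every non-empty even level of
canonical rank one is joined to `n₀` by rungs `a — a ∪ {q₁,q₂}` through odd CORE levels (`Sel_{a∪q₁}^± = 0`) — the E-side
residual (Howard 2006 Prop. 2.4.11: Čebotarev + global duality; tree: (A1) landed, (R) modulo Poitou–Tate). No ♯-frame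
hypothesis is used (rank lowering is not needed here). Output: `Nonempty (LevelKolyvaginSystemP W K p Dt β ι c)` — the
conclusion of crux KS′ at the frame; `transport` by `exists_ne_zero_of_reciprocity_of_notMem_baseLocusQP` (w3), `baseCase`
by `ne_zero_of_coreRungs`, odd levels filled with `0` (`nonempty_levelKolyvaginSystemP_of_evenLevels`, w2). CONDITIONAL;
closes nothing. [cite: WZhang2014, Thm. 4.3, Thm. 7.2, §8.1, §9] [cite: Howard2006Bipartite, Prop. 2.4.11, Thm. 2.5.1]
[cite: GrossLMS1991, Prop. 6.2] -/
theorem nonempty_levelKolyvaginSystemP_of_reciprocity_of_ignition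
    (ε₀ : Finset (AdmQ W K p) → Bool)
    (κ₀ : Finset {ℓ // Zhang2014.IsKolyvaginPrime (W.conductorNorm ℤ) W K p ℓ} → Finset (AdmQ W K p) → Vp W K p)
    (realisation : ∀ m : Finset {ℓ // Zhang2014.IsKolyvaginPrime (W.conductorNorm ℤ) W K p ℓ},
      ∃ d : KolyvaginHeegnerData Dt β ι (∏ ℓ ∈ m, (ℓ : ℕ)), κ₀ m ∅ = d.kolyvaginClass (Fact.out : p.Prime) 1)
    (sign : ∀ n : Finset (AdmQ W K p), n.Nonempty → Even n.card →
      ∀ m : Finset {ℓ // Zhang2014.IsKolyvaginPrime (W.conductorNorm ℤ) W K p ℓ},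
      conjAct W c ((p ^ 1 : ℕ) : ℤ) (κ₀ m n) = sgnP (ε₀ n ^^ Nat.bodd m.card) • κ₀ m n)
    (selmer_off : ∀ n : Finset (AdmQ W K p), n.Nonempty → Even n.card →
      ∀ (m : Finset {ℓ // Zhang2014.IsKolyvaginPrime (W.conductorNorm ℤ) W K p ℓ}) (v : HeightOneSpectrum (𝓞 K)),
      (∀ ℓ ∈ m, ((ℓ : ℕ) : 𝓞 K) ∉ v.asIdeal) → (∀ q ∈ n, ((q : ℕ) : 𝓞 K) ∉ v.asIdeal) →
      κ₀ m n ∈ selmerLocalKer (W.baseChange K) (v.adicCompletion K) ((p ^ 1 : ℕ) : ℤ))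
    (selmer_inf : ∀ n : Finset (AdmQ W K p), n.Nonempty → Even n.card →
      ∀ (m : Finset {ℓ // Zhang2014.IsKolyvaginPrime (W.conductorNorm ℤ) W K p ℓ}) (w : InfinitePlace K),
      κ₀ m n ∈ selmerLocalKer (W.baseChange K) w.Completion ((p ^ 1 : ℕ) : ℤ))
    (toric_on : ∀ n : Finset (AdmQ W K p), n.Nonempty → Even n.card →
      ∀ m : Finset {ℓ // Zhang2014.IsKolyvaginPrime (W.conductorNorm ℤ) W K p ℓ}, ∀ q ∈ n,
      ∀ v : HeightOneSpectrum (𝓞 K),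
      ((q : ℕ) : 𝓞 K) ∈ v.asIdeal → κ₀ m n ∈ toricLocalKer (W.baseChange K) (v.adicCompletion K) ((p ^ 1 : ℕ) : ℤ))
    (transverse_on : ∀ n : Finset (AdmQ W K p), n.Nonempty → Even n.card →
      ∀ m : Finset {ℓ // Zhang2014.IsKolyvaginPrime (W.conductorNorm ℤ) W K p ℓ}, ∀ ℓ ∈ m,
      ∀ v : HeightOneSpectrum (𝓞 K),
      ((ℓ : ℕ) : 𝓞 K) ∈ v.asIdeal → κ₀ m n ∈ transverseLocalKerP W K p ι ℓ v)
    (relation : ∀ n : Finset (AdmQ W K p), n.Nonempty → Even n.card →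
      ∀ (m : Finset {ℓ // Zhang2014.IsKolyvaginPrime (W.conductorNorm ℤ) W K p ℓ})
        (ℓ : {ℓ // Zhang2014.IsKolyvaginPrime (W.conductorNorm ℤ) W K p ℓ}), ℓ ∉ m → ∀ v : HeightOneSpectrum (𝓞 K),
      ((ℓ : ℕ) : 𝓞 K) ∈ v.asIdeal →
      (κ₀ (insert ℓ m) n ∈ (W.baseChange K).torsionLocalKer (v.adicCompletion K) ((p ^ 1 : ℕ) : ℤ) ↔
        κ₀ m n ∈ (W.baseChange K).torsionLocalKer (v.adicCompletion K) ((p ^ 1 : ℕ) : ℤ)))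
    (reciprocity : ∀ (n : Finset (AdmQ W K p)) (q₁ q₂ : AdmQ W K p), q₁ ∉ n → q₂ ∉ insert q₁ n → Even n.card →
      ∀ (m : Finset {ℓ // Zhang2014.IsKolyvaginPrime (W.conductorNorm ℤ) W K p ℓ}) (v₁ v₂ : HeightOneSpectrum (𝓞 K)),
      ((q₁ : ℕ) : 𝓞 K) ∈ v₁.asIdeal → ((q₂ : ℕ) : 𝓞 K) ∈ v₂.asIdeal →
      (κ₀ m n ∈ (W.baseChange K).torsionLocalKer (v₁.adicCompletion K) ((p ^ 1 : ℕ) : ℤ) ↔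
        κ₀ m (insert q₂ (insert q₁ n)) ∈ (W.baseChange K).torsionLocalKer (v₂.adicCompletion K) ((p ^ 1 : ℕ) : ℤ)))
    (selmer_bottom : ∃ μ : Bool, κ₀ ∅ ∅ ∈ SelQP W K p c ∅ μ)
    (n₀ : Finset (AdmQ W K p)) (hn₀ : Even n₀.card) (ignition : κ₀ ∅ n₀ ≠ 0)
    (connected : ∀ n : Finset (AdmQ W K p), n.Nonempty → Even n.card →
      finrank (ZMod p) (SelQP W K p c n true) + finrank (ZMod p) (SelQP W K p c n false) = 1 →
      Relation.EqvGen (fun a b : Finset (AdmQ W K p) ↦ ∃ q₁ q₂, q₁ ∉ a ∧ q₂ ∉ insert q₁ a ∧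
        b = insert q₂ (insert q₁ a) ∧ SelQP W K p c (insert q₁ a) true = ⊥ ∧ SelQP W K p c (insert q₁ a) false = ⊥)
        n₀ n) :
    Nonempty (LevelKolyvaginSystemP W K p Dt β ι c) := by
  -- the conductor-one classes lie in the level spaces at every even level
  have hmem : ∀ n : Finset (AdmQ W K p), Even n.card → ∃ μ, κ₀ ∅ n ∈ SelQP W K p c n μ := by
    intro n hn
    rcases n.eq_empty_or_nonempty with rfl | hne
    · exact selmer_bottom
    · refine ⟨ε₀ n, (mem_selQP_iff W K p c n (ε₀ n) _).mpr ⟨?_, selmer_inf n hne hn ∅, fun v hv ↦ ?_,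
        fun q hq v hqv ↦ toric_on n hne hn ∅ q hq v hqv⟩⟩
      · simpa only [Finset.card_empty, Nat.bodd_zero, Bool.xor_false] using sign n hne hn ∅
      · exact selmer_off n hne hn ∅ v (fun ℓ hℓ ↦ absurd hℓ (Finset.notMem_empty ℓ)) hv
  refine nonempty_levelKolyvaginSystemP_of_evenLevels W K p c Dt β ι ε₀ κ₀ realisation sign selmer_off selmer_inf
    toric_on transverse_on relation ?_ ?_
  · -- transport (A2) from (SRL)
    intro n q₁ q₂ hq₁ hq₂ he hbase
    exact exists_ne_zero_of_reciprocity_of_notMem_baseLocusQP W K p κ₀ (reciprocity n q₁ q₂ hq₁ hq₂ he) hbase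
  · -- base case (A5) from ONE ignition along the rungs
    intro n hne he h1
    exact (ne_zero_of_coreRungs W K p c (κ₀ ∅) (fun n q₁ q₂ hq₁ hq₂ hn ↦ reciprocity n q₁ q₂ hq₁ hq₂ hn ∅) hmem hn₀
      ignition (connected n hne he h1)).2

/-- **KS′'s conclusion from a BIPARTITE datum, ONE SEED and CORE-CONNECTIVITY** — w2's `nonempty_levelKolyvaginSystemP_of_bipartite`
with the laws (A), (B) two-sided and the rank-0 ANCHOR AT EVERY ODD LEVEL + (A1) REPLACED by: `selmer_bottom` (as above);
ONE SEED — a non-zero conductor-one class `κ₀(∅, n₀)` at an even level OR a unit value `λ(∅, n₀)` at an odd level (ONE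
instance of the anchor (γ), or one computed special value); CONNECTED — every non-empty even level of canonical rank one is
joined to `n₀` in Howard's core graph (edges `a — a ∪ {q}`, the odd end core). Laws: (A) «`λ(m, n∪q) ≠ 0 ⟺ κ₀(m, n)` detected
above `q`» (`n` even; BD05 Thm. 4.2, Zhang (4.8)), (B) «`κ₀(m, n'∪q)` detected above `q ⟺ λ(m, n') ≠ 0`» (`n'` odd; BD05
Thm. 4.1) — their one-directional halves give `transport` (w2's `transport_of_reciprocityLaws`), both directions at `m = ∅`
give `baseCase` by `ne_zero_of_coreEdges`. CONDITIONAL; closes nothing; no ♯-frame hypothesis used.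
[cite: Howard2006Bipartite, Prop. 2.4.11, Cor. 2.4.12, Thm. 2.5.1] [cite: BertoliniDarmon2005, Thm. 4.1, Thm. 4.2]
[cite: WZhang2014, Thm. 4.3, (4.8), Thm. 7.2, §9] -/
theorem nonempty_levelKolyvaginSystemP_of_bipartite_of_seed
    (ε₀ : Finset (AdmQ W K p) → Bool)
    (κ₀ : Finset {ℓ // Zhang2014.IsKolyvaginPrime (W.conductorNorm ℤ) W K p ℓ} → Finset (AdmQ W K p) → Vp W K p)
    (lam : Finset {ℓ // Zhang2014.IsKolyvaginPrime (W.conductorNorm ℤ) W K p ℓ} → Finset (AdmQ W K p) → ZMod p)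
    (realisation : ∀ m : Finset {ℓ // Zhang2014.IsKolyvaginPrime (W.conductorNorm ℤ) W K p ℓ},
      ∃ d : KolyvaginHeegnerData Dt β ι (∏ ℓ ∈ m, (ℓ : ℕ)), κ₀ m ∅ = d.kolyvaginClass (Fact.out : p.Prime) 1)
    (sign : ∀ n : Finset (AdmQ W K p), n.Nonempty → Even n.card →
      ∀ m : Finset {ℓ // Zhang2014.IsKolyvaginPrime (W.conductorNorm ℤ) W K p ℓ},
      conjAct W c ((p ^ 1 : ℕ) : ℤ) (κ₀ m n) = sgnP (ε₀ n ^^ Nat.bodd m.card) • κ₀ m n)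
    (selmer_off : ∀ n : Finset (AdmQ W K p), n.Nonempty → Even n.card →
      ∀ (m : Finset {ℓ // Zhang2014.IsKolyvaginPrime (W.conductorNorm ℤ) W K p ℓ}) (v : HeightOneSpectrum (𝓞 K)),
      (∀ ℓ ∈ m, ((ℓ : ℕ) : 𝓞 K) ∉ v.asIdeal) → (∀ q ∈ n, ((q : ℕ) : 𝓞 K) ∉ v.asIdeal) →
      κ₀ m n ∈ selmerLocalKer (W.baseChange K) (v.adicCompletion K) ((p ^ 1 : ℕ) : ℤ))
    (selmer_inf : ∀ n : Finset (AdmQ W K p), n.Nonempty → Even n.card →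
      ∀ (m : Finset {ℓ // Zhang2014.IsKolyvaginPrime (W.conductorNorm ℤ) W K p ℓ}) (w : InfinitePlace K),
      κ₀ m n ∈ selmerLocalKer (W.baseChange K) w.Completion ((p ^ 1 : ℕ) : ℤ))
    (toric_on : ∀ n : Finset (AdmQ W K p), n.Nonempty → Even n.card →
      ∀ m : Finset {ℓ // Zhang2014.IsKolyvaginPrime (W.conductorNorm ℤ) W K p ℓ}, ∀ q ∈ n,
      ∀ v : HeightOneSpectrum (𝓞 K),
      ((q : ℕ) : 𝓞 K) ∈ v.asIdeal → κ₀ m n ∈ toricLocalKer (W.baseChange K) (v.adicCompletion K) ((p ^ 1 : ℕ) : ℤ))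
    (transverse_on : ∀ n : Finset (AdmQ W K p), n.Nonempty → Even n.card →
      ∀ m : Finset {ℓ // Zhang2014.IsKolyvaginPrime (W.conductorNorm ℤ) W K p ℓ}, ∀ ℓ ∈ m,
      ∀ v : HeightOneSpectrum (𝓞 K),
      ((ℓ : ℕ) : 𝓞 K) ∈ v.asIdeal → κ₀ m n ∈ transverseLocalKerP W K p ι ℓ v)
    (relation : ∀ n : Finset (AdmQ W K p), n.Nonempty → Even n.card →
      ∀ (m : Finset {ℓ // Zhang2014.IsKolyvaginPrime (W.conductorNorm ℤ) W K p ℓ})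
        (ℓ : {ℓ // Zhang2014.IsKolyvaginPrime (W.conductorNorm ℤ) W K p ℓ}), ℓ ∉ m → ∀ v : HeightOneSpectrum (𝓞 K),
      ((ℓ : ℕ) : 𝓞 K) ∈ v.asIdeal →
      (κ₀ (insert ℓ m) n ∈ (W.baseChange K).torsionLocalKer (v.adicCompletion K) ((p ^ 1 : ℕ) : ℤ) ↔
        κ₀ m n ∈ (W.baseChange K).torsionLocalKer (v.adicCompletion K) ((p ^ 1 : ℕ) : ℤ)))
    (lawA : ∀ (n : Finset (AdmQ W K p)) (q : AdmQ W K p), Even n.card → q ∉ n →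
      ∀ m : Finset {ℓ // Zhang2014.IsKolyvaginPrime (W.conductorNorm ℤ) W K p ℓ},
      lam m (insert q n) ≠ 0 ↔ ∃ v : HeightOneSpectrum (𝓞 K), ((q : ℕ) : 𝓞 K) ∈ v.asIdeal ∧
        κ₀ m n ∉ (W.baseChange K).torsionLocalKer (v.adicCompletion K) ((p ^ 1 : ℕ) : ℤ))
    (lawB : ∀ (n : Finset (AdmQ W K p)) (q : AdmQ W K p), Odd n.card → q ∉ n →
      ∀ m : Finset {ℓ // Zhang2014.IsKolyvaginPrime (W.conductorNorm ℤ) W K p ℓ},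
      (∃ v : HeightOneSpectrum (𝓞 K), ((q : ℕ) : 𝓞 K) ∈ v.asIdeal ∧
        κ₀ m (insert q n) ∉ (W.baseChange K).torsionLocalKer (v.adicCompletion K) ((p ^ 1 : ℕ) : ℤ)) ↔ lam m n ≠ 0)
    (selmer_bottom : ∃ μ : Bool, κ₀ ∅ ∅ ∈ SelQP W K p c ∅ μ)
    (n₀ : Finset (AdmQ W K p)) (seed : (Even n₀.card ∧ κ₀ ∅ n₀ ≠ 0) ∨ (Odd n₀.card ∧ lam ∅ n₀ ≠ 0))
    (connected : ∀ n : Finset (AdmQ W K p), n.Nonempty → Even n.card →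
      finrank (ZMod p) (SelQP W K p c n true) + finrank (ZMod p) (SelQP W K p c n false) = 1 →
      Relation.EqvGen (fun a b : Finset (AdmQ W K p) ↦ ∃ q, q ∉ a ∧ b = insert q a ∧
        (Even a.card → SelQP W K p c (insert q a) true = ⊥ ∧ SelQP W K p c (insert q a) false = ⊥) ∧
        (Odd a.card → SelQP W K p c a true = ⊥ ∧ SelQP W K p c a false = ⊥)) n₀ n) :
    Nonempty (LevelKolyvaginSystemP W K p Dt β ι c) := by
  -- the conductor-one classes lie in the level spaces at every even level
  have hmem : ∀ n : Finset (AdmQ W K p), Even n.card → ∃ μ, κ₀ ∅ n ∈ SelQP W K p c n μ := by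
    intro n hn
    rcases n.eq_empty_or_nonempty with rfl | hne
    · exact selmer_bottom
    · refine ⟨ε₀ n, (mem_selQP_iff W K p c n (ε₀ n) _).mpr ⟨?_, selmer_inf n hne hn ∅, fun v hv ↦ ?_,
        fun q hq v hqv ↦ toric_on n hne hn ∅ q hq v hqv⟩⟩
      · simpa only [Finset.card_empty, Nat.bodd_zero, Bool.xor_false] using sign n hne hn ∅
      · exact selmer_off n hne hn ∅ v (fun ℓ hℓ ↦ absurd hℓ (Finset.notMem_empty ℓ)) hv
  refine nonempty_levelKolyvaginSystemP_of_evenLevels W K p c Dt β ι ε₀ κ₀ realisation sign selmer_off selmer_inf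
    toric_on transverse_on relation
    (transport_of_reciprocityLaws W K p (fun n q hn hq m h ↦ (lawA n q hn hq m).mp h)
      (fun n q hn hq m v hv h ↦ (lawB n q hn hq m).mp ⟨v, hv, h⟩)) ?_
  -- base case (A5) from the seed along Howard's core graph, at conductor `∅`
  intro n hne he h1
  exact ne_zero_of_coreEdges W K p c (κ₀ ∅) (fun n' ↦ lam ∅ n' ≠ 0)
    (fun n q hn hq ↦ (lawA n q hn hq ∅).symm) (fun n' q hn' hq ↦ lawB n' q hn' hq ∅) hmem seed he
    (connected n hne he h1)

end Assembly

end Summit.BirchSwinnertonDyer.BirchSwinnertonDyer.Theorems.AdditiveKoly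

end
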